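import Summits.NavierStokesRegularity.NavierStokesRegularity.Theorems.ThreadingFluxCentreVirialFacts
import Summits.NavierStokesRegularity.NavierStokesRegularity.Theorems.ThreadingFluxCentreVirialBallFlux
import HarnessLib

/-!
# Crux `PoloidalLiouville` (stmt-NavierStokesRegularity-1222, W1), crux idea «centre-virial» (ns-idea-15 g9):
# (B) the FLUX PROFILE exists — unconditionally

`fluxProfile : FluxProfile` (the card's statement B, by name over the twin `ThreadingFluxCentreVirialDefs`): for every
`D`-solution `(u, p)` and centre `x₀` there is a profile `G` with (i) the ball inequality `t³G(t) ≤ −½∫_{B_t}|u|²`, (ii) the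
shell identity `G(b) − G(a) = ∫_shell r⁻³|u_tan|² − 2∫_shell r⁻³u_r²`, (iii) `G → 0`.  Route r1 of the critic of record
(V25-P2, sphere-free): `G(t) := t⁻³ ∫_{|y| ≤ t} (3(p − p₀) + |u|²)`, `p₀` the pressure limit (F1, a tree theorem:
`dSolutionPressureLimit`); (i) is the head sign (F2, tree theorem `headNonpositive`) pointwise; (ii) is the ball/shell
Gauss–Green identity `ball_shell_flux` for `F = (p − p₀)y + m u + ω × y` (`div F = 3(p − p₀) + |u|²` by V1
`centreVirialIdentity`) with density `shellDensity (a²)`, `⟪F, y⟫ = (p − p₀)r² + m²`, and one null sphere; (iii) is Cesàro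
from `p → p₀`, `u → 0` (`|B_t| = t³|B_1|`).  Helpers: pressure-shift invariance of the steady class, `C¹`-smoothness of the
flux field, integrability on shells from continuity on the closed shell.

Information-grade; W1 movement 0; `PoloidalLiouville` (1222), T0, Galdi's problem OPEN; NS regularity is NOT proved.
`--supports stmt-NavierStokesRegularity-1222 --as helper`.  Filed by ns-wall-eng-4 g6 (cell ns-wall-extremal).
[cite: KorobkovPileckasRusso2015, Thm 3.6] [cite: Galdi2011, Thm X.5.1]
-/

-- the summit and its single sub-problem share the name (CONVENTIONS §1)
set_option linter.dupNamespace false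

noncomputable section

namespace Summit.NavierStokesRegularity.NavierStokesRegularity.Theorems.PoloidalLiouville.CentreVirial

open Set Function MeasureTheory Filter Topology
open Literature.Analysis.FluidPDE
open Literature.Analysis.FluidPDE.VectorCalculus (divergence IsDivFree)
open Summit.NavierStokesRegularity.NavierStokesRegularity.Theorems.PoloidalLiouville.CentreJet
  (E3 IsUnthreadedAbout IsSteadyNSOn)
open scoped RealInnerProductSpace

/-- The steady class is invariant under constant pressure shifts. -/
theorem isSteadyNSOn_sub_const {u : E3 → E3} {p : E3 → ℝ} (h : IsSteadyNSOn univ u p) (c : ℝ) :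
    IsSteadyNSOn univ u (fun x => p x - c) := by
  refine ⟨h.1, contDiffOn_univ.mpr ((contDiffOn_univ.mp h.2.1).sub contDiff_const), h.2.2.1, fun x hx => ?_⟩
  have e := h.2.2.2 x hx
  have hg : gradient (fun x => p x - c) x = gradient p x := by
    unfold gradient
    rw [fderiv_sub_const]
  rw [hg]
  exact e

/-- The flux field of a `C³`/`C¹` pair is `C¹`. -/
theorem contDiff_virialField {u : E3 → E3} {p : E3 → ℝ} (x₀ : E3) (hu : ContDiff ℝ 3 u) (hp : ContDiff ℝ 1 p) :
    ContDiff ℝ 1 (virialField x₀ u p) := by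
  have hy : ContDiff ℝ 1 (fun x : E3 => x - x₀) := contDiff_id.sub contDiff_const
  have hu1 : ContDiff ℝ 1 u := hu.of_le (by norm_num)
  have hu2 : ContDiff ℝ 2 u := hu.of_le (by norm_num)
  have hm : ContDiff ℝ 1 (mom x₀ u) := hy.inner ℝ hu1
  have hcurl : ContDiff ℝ 1 (curl u) := by
    rw [curl_eq_curlCLM_comp]
    exact curlCLM.contDiff.comp (hu2.fderiv_right le_rfl)
  have hcross : ContDiff ℝ 1 (fun x => cross (curl u x) (x - x₀)) :=
    (crossCLM.contDiff.comp hcurl).clm_apply hy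
  unfold virialField
  exact ((hp.smul hy).add (hm.smul hu1)).add hcross

/-- `⟪F(x), y⟫ = p r² + m²` (`ω × y ⟂ y`). -/
theorem inner_virialField_self (x₀ : E3) (u : E3 → E3) (p : E3 → ℝ) (x : E3) :
    ⟪virialField x₀ u p x, x - x₀⟫ = p x * ‖x - x₀‖ ^ 2 + mom x₀ u x ^ 2 := by
  have hc : ⟪cross (curl u x) (x - x₀), x - x₀⟫ = 0 := by
    simp only [cross, PiLp.inner_apply, cross_apply, RCLike.inner_apply, conj_trivial,
      Fin.sum_univ_three, Matrix.cons_val_zero, Matrix.cons_val_one, Matrix.cons_val_two,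
      Matrix.head_cons, Matrix.tail_cons]
    ring
  unfold virialField
  rw [inner_add_left, inner_add_left, real_inner_smul_left, real_inner_smul_left, real_inner_self_eq_norm_sq,
    real_inner_comm (x - x₀) (u x), hc]
  unfold mom
  ring

/-- Continuity on the closed shell `a ≤ |y| ≤ b` gives integrability on the half-open shell `a < |y| ≤ b` and on the
sketch's open shell `a < |y| < b`. -/
theorem integrableOn_of_continuousOn_closedShell {f : E3 → ℝ} {x₀ : E3} {a b : ℝ}
    (hf : ContinuousOn f (Metric.closedBall x₀ b \ Metric.ball x₀ a)) :
    IntegrableOn f {x | a < ‖x - x₀‖ ∧ ‖x - x₀‖ ≤ b} volume ∧ IntegrableOn f (shell x₀ a b) volume := by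
  have hK : IsCompact (Metric.closedBall x₀ b \ Metric.ball x₀ a) := (isCompact_closedBall x₀ b).diff Metric.isOpen_ball
  have hI : IntegrableOn f (Metric.closedBall x₀ b \ Metric.ball x₀ a) volume := hf.integrableOn_compact hK
  constructor
  · refine hI.mono_set fun x hx => ?_
    simp only [Set.mem_setOf_eq] at hx
    simp only [Set.mem_sdiff, Metric.mem_closedBall, Metric.mem_ball, dist_eq_norm, not_lt]
    exact ⟨hx.2, hx.1.le⟩
  · refine hI.mono_set fun x hx => ?_
    simp only [shell, Set.mem_setOf_eq] at hx
    simp only [Set.mem_sdiff, Metric.mem_closedBall, Metric.mem_ball, dist_eq_norm, not_lt]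
    exact ⟨hx.2.le, hx.1.le⟩

/-- **(B) `FluxProfile` — the flux profile EXISTS, unconditionally.**  For every `D`-solution `(u, p)` and centre `x₀`,
with `p₀` the pressure limit at infinity (F1, from the tree) and the VOLUME profile
`G(t) := t⁻³ ∫_{|y| ≤ t} (3(p − p₀) + |u|²) dx` (= `t⁻² ∮_{S_t}(p − p₀ + u_r²) dσ` by (V1); the sphere-free route r1 of
the critic's V25-P2): (i) the ball inequality `t³G(t) ≤ −½∫_{B_t}|u|²` is the head sign F2 pointwise
(`3(p−p₀)+|u|² = 3Φ − |u|²/2 ≤ −|u|²/2`); (ii) the shell identity `G(b) − G(a) = ∫_shell r⁻³|u_tan|² − 2∫_shell r⁻³u_r²`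
is the ball/shell Gauss–Green identity `ball_shell_flux` for `F = (p − p₀)y + m u + ω × y` (div F = 3(p−p₀)+|u|² by V1)
with the density `ζ(τ) = (3/2)τ^{-5/2}`, plus `⟪F, y⟫ = (p−p₀)r² + m²`; (iii) `G → 0` because `3(p − p₀) + |u|² → 0` at
infinity and `|B_t| = t³|B_1|` (Cesàro).  [idea-15 g9 card «centre-virial» (B); KPR 2015 Thm 3.6 is the cylindrical
ancestor.] [cite: KorobkovPileckasRusso2015, Thm 3.6] -/
theorem fluxProfile : FluxProfile := by
  intro u p x₀ hD
  obtain ⟨p₀, hp₀⟩ := dSolutionPressureLimit u p hD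
  have hhead := headNonpositive u p p₀ hD hp₀
  have hNS' : IsSteadyNSOn univ u (fun x => p x - p₀) := isSteadyNSOn_sub_const hD.1 p₀
  have hu3 : ContDiff ℝ 3 u := contDiffOn_univ.mp hD.1.1
  have hp1 : ContDiff ℝ 1 p := contDiffOn_univ.mp hD.1.2.1
  have huc : Continuous u := hu3.continuous
  have hpc : Continuous p := hp1.continuous
  set F : E3 → E3 := virialField x₀ u (fun x => p x - p₀) with hF_def
  have hF : ContDiff ℝ 1 F := contDiff_virialField x₀ hu3 (hp1.sub contDiff_const)
  set D : E3 → ℝ := fun x => 3 * (p x - p₀) + ‖u x‖ ^ 2 with hD_def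
  have hdivF : ∀ x, divergence F x = D x := fun x => centreVirialIdentity u _ x₀ hNS' x
  have hDc : Continuous D := (continuous_const.mul (hpc.sub continuous_const)).add (huc.norm.pow 2)
  have hFy : ∀ x, ⟪F x, x - x₀⟫ = (p x - p₀) * ‖x - x₀‖ ^ 2 + mom x₀ u x ^ 2 := fun x =>
    inner_virialField_self x₀ u _ x
  have hmc : Continuous (mom x₀ u) := (continuous_id.sub continuous_const).inner huc
  set Φ : ℝ → ℝ := fun t => ∫ x in Metric.closedBall x₀ t, D x with hΦ_def
  refine ⟨fun t => (t ^ 3)⁻¹ * Φ t, ?_, ?_, ?_⟩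
  · ------------------------------------------------------------------ (i) ball inequality
    intro t ht
    have h3 : t ^ 3 * ((t ^ 3)⁻¹ * Φ t) = Φ t := by
      have : t ^ 3 ≠ 0 := by positivity
      field_simp
    rw [h3]
    have hI1 : IntegrableOn D (Metric.closedBall x₀ t) volume :=
      hDc.continuousOn.integrableOn_compact (isCompact_closedBall x₀ t)
    have hI2 : IntegrableOn (fun x => ‖u x‖ ^ 2) (Metric.closedBall x₀ t) volume :=
      (huc.norm.pow 2).continuousOn.integrableOn_compact (isCompact_closedBall x₀ t)
    have hle : Φ t ≤ ∫ x in Metric.closedBall x₀ t, -(1 / 2) * ‖u x‖ ^ 2 := by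
      refine setIntegral_mono_on hI1 (hI2.const_mul _) Metric.isClosed_closedBall.measurableSet fun x _ => ?_
      have := hhead x
      show 3 * (p x - p₀) + ‖u x‖ ^ 2 ≤ -(1 / 2) * ‖u x‖ ^ 2
      linarith
    rw [integral_const_mul] at hle
    have hmono : ∫ x in Metric.ball x₀ t, ‖u x‖ ^ 2 ≤ ∫ x in Metric.closedBall x₀ t, ‖u x‖ ^ 2 :=
      setIntegral_mono_set hI2 (Eventually.of_forall fun x => sq_nonneg _)
        (Eventually.of_forall Metric.ball_subset_closedBall)
    linarith
  · ------------------------------------------------------------------ (ii) shell identity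
    intro a b ha hab
    have hb : 0 < b := ha.trans hab
    have hα : 0 < a ^ 2 := by positivity
    set T : Set E3 := {x | a < ‖x - x₀‖ ∧ ‖x - x₀‖ ≤ b} with hT_def
    have hTm : MeasurableSet T := by
      have : T = Metric.closedBall x₀ b \ Metric.closedBall x₀ a := by
        ext x; simp [hT_def, Metric.mem_closedBall, dist_eq_norm, and_comm]
      rw [this]
      exact Metric.isClosed_closedBall.measurableSet.diff Metric.isClosed_closedBall.measurableSet
    have key := ball_shell_flux hF x₀ (continuous_shellDensity hα) ha.le hab
    -- the radial integrals of the density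
    have hI0 : ∫ τ in (a ^ 2)..(b ^ 2), shellDensity (a ^ 2) τ = (a ^ 3)⁻¹ - (b ^ 3)⁻¹ := by
      rw [integral_shellDensity hα le_rfl (pow_le_pow_left₀ ha.le hab.le 2), Real.sqrt_sq ha.le, Real.sqrt_sq hb.le]
      ring
    have hIx : ∀ x ∈ T, ∫ τ in (‖x - x₀‖ ^ 2)..(b ^ 2), shellDensity (a ^ 2) τ = (‖x - x₀‖ ^ 3)⁻¹ - (b ^ 3)⁻¹ := by
      intro x hx
      rw [integral_shellDensity hα (pow_le_pow_left₀ ha.le hx.1.le 2) (pow_le_pow_left₀ (norm_nonneg _) hx.2 2),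
        Real.sqrt_sq (norm_nonneg _), Real.sqrt_sq hb.le]
      ring
    have hζx : ∀ x ∈ T, shellDensity (a ^ 2) (‖x - x₀‖ ^ 2) = 3 / (2 * ‖x - x₀‖ ^ 5) := by
      intro x hx
      unfold shellDensity
      rw [max_eq_left (pow_le_pow_left₀ ha.le hx.1.le 2), Real.sqrt_sq (norm_nonneg _)]
      ring
    -- rewrite the identity
    have e1 : ∫ x in T, (∫ τ in (‖x - x₀‖ ^ 2)..(b ^ 2), shellDensity (a ^ 2) τ) * divergence F x =
        ∫ x in T, ((‖x - x₀‖ ^ 3)⁻¹ - (b ^ 3)⁻¹) * D x :=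
      setIntegral_congr_fun hTm fun x hx => by simp only [hIx x hx, hdivF x]
    have e2 : ∫ x in T, shellDensity (a ^ 2) (‖x - x₀‖ ^ 2) * ⟪F x, x - x₀⟫ =
        ∫ x in T, 3 / (2 * ‖x - x₀‖ ^ 5) * ((p x - p₀) * ‖x - x₀‖ ^ 2 + mom x₀ u x ^ 2) :=
      setIntegral_congr_fun hTm fun x hx => by simp only [hζx x hx, hFy x]
    have e3 : ∫ x in Metric.closedBall x₀ a, divergence F x = Φ a :=
      setIntegral_congr_fun Metric.isClosed_closedBall.measurableSet fun x _ => hdivF x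
    rw [hI0, e1, e2, e3] at key
    -- integrability on `T` and on the open shell
    have hr0 : ∀ x ∈ Metric.closedBall x₀ b \ Metric.ball x₀ a, ‖x - x₀‖ ≠ 0 := by
      intro x hx
      simp only [Set.mem_sdiff, Metric.mem_ball, dist_eq_norm, not_lt] at hx
      exact (ha.trans_le hx.2).ne'
    have hcn : ContinuousOn (fun x : E3 => ‖x - x₀‖) (Metric.closedBall x₀ b \ Metric.ball x₀ a) :=
      (continuous_norm.comp (continuous_id.sub continuous_const)).continuousOn
    have hW1 := integrableOn_of_continuousOn_closedShell (x₀ := x₀) (a := a) (b := b)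
      (f := fun x => (‖x - x₀‖ ^ 3)⁻¹ * D x)
      (((hcn.pow 3).inv₀ fun x hx => pow_ne_zero 3 (hr0 x hx)).mul hDc.continuousOn)
    have hW2 := integrableOn_of_continuousOn_closedShell (x₀ := x₀) (a := a) (b := b) (f := D) hDc.continuousOn
    have hW3 := integrableOn_of_continuousOn_closedShell (x₀ := x₀) (a := a) (b := b)
      (f := fun x => 3 / (2 * ‖x - x₀‖ ^ 5) * ((p x - p₀) * ‖x - x₀‖ ^ 2 + mom x₀ u x ^ 2))
      ((continuousOn_const.div (continuousOn_const.mul (hcn.pow 5)) fun x hx =>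
          mul_ne_zero two_ne_zero (pow_ne_zero 5 (hr0 x hx))).mul
        ((((hpc.sub continuous_const).continuousOn).mul (hcn.pow 2)).add (hmc.pow 2).continuousOn))
    have hWt := integrableOn_of_continuousOn_closedShell (x₀ := x₀) (a := a) (b := b) (f := tanDensity x₀ u)
      (by
        unfold tanDensity
        exact (((hcn.pow 2).mul (huc.norm.pow 2).continuousOn).sub (hmc.pow 2).continuousOn).div (hcn.pow 5)
          fun x hx => pow_ne_zero 5 (hr0 x hx))
    have hWr := integrableOn_of_continuousOn_closedShell (x₀ := x₀) (a := a) (b := b) (f := radDensity x₀ u)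
      (by
        unfold radDensity
        exact (hmc.pow 2).continuousOn.div (hcn.pow 5) fun x hx => pow_ne_zero 5 (hr0 x hx))
    -- split the `T`-integral on the left of `key`
    have hsplit : ∫ x in T, ((‖x - x₀‖ ^ 3)⁻¹ - (b ^ 3)⁻¹) * D x =
        (∫ x in T, (‖x - x₀‖ ^ 3)⁻¹ * D x) - (b ^ 3)⁻¹ * ∫ x in T, D x := by
      rw [← integral_const_mul, ← integral_sub hW1.1 (hW2.1.const_mul _)]
      refine setIntegral_congr_fun hTm fun x _ => ?_
      ring
    rw [hsplit] at key
    -- `Φ b = Φ a + ∫_T D`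
    have hΦb : Φ b = Φ a + ∫ x in T, D x := by
      have hunion : Metric.closedBall x₀ b = Metric.closedBall x₀ a ∪ T := by
        ext x
        simp only [Metric.mem_closedBall, dist_eq_norm, Set.mem_union, hT_def, Set.mem_setOf_eq]
        constructor
        · intro h; by_cases h' : ‖x - x₀‖ ≤ a
          · exact Or.inl h'
          · exact Or.inr ⟨not_le.1 h', h⟩
        · rintro (h | h)
          · exact h.trans hab.le
          · exact h.2
      have hdisj : Disjoint (Metric.closedBall x₀ a) T := by
        rw [Set.disjoint_left]
        intro x hx hx'
        rw [Metric.mem_closedBall, dist_eq_norm] at hx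
        exact (not_lt.2 hx) hx'.1
      show ∫ x in Metric.closedBall x₀ b, D x = (∫ x in Metric.closedBall x₀ a, D x) + ∫ x in T, D x
      rw [hunion, setIntegral_union hdisj hTm (hDc.continuousOn.integrableOn_compact (isCompact_closedBall x₀ a)) hW2.1]
    -- the integrand identity on `T`
    have hpt : ∀ x ∈ T, tanDensity x₀ u x - 2 * radDensity x₀ u x =
        (‖x - x₀‖ ^ 3)⁻¹ * D x - 2 * (3 / (2 * ‖x - x₀‖ ^ 5) * ((p x - p₀) * ‖x - x₀‖ ^ 2 + mom x₀ u x ^ 2)) := by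
      intro x hx
      have hr : ‖x - x₀‖ ≠ 0 := (ha.trans hx.1).ne'
      unfold tanDensity radDensity
      field_simp
      ring
    -- `T` and the open shell differ by a null sphere
    have hae : (T : Set E3) =ᵐ[volume] shell x₀ a b := by
      refine (ae_eq_set).2 ⟨?_, ?_⟩
      · refine measure_mono_null (fun x hx => ?_) (Measure.addHaar_sphere volume x₀ b)
        simp only [Set.mem_sdiff, hT_def, shell, Set.mem_setOf_eq, not_and, not_lt] at hx
        rw [Metric.mem_sphere, dist_eq_norm]
        exact le_antisymm hx.1.2 (hx.2 hx.1.1)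
      · have : shell x₀ a b \ T = ∅ :=
          Set.sdiff_eq_empty.mpr fun x hx => ⟨hx.1, hx.2.le⟩
        rw [this, measure_empty]
    -- conclude
    have hgoal : (∫ x in shell x₀ a b, tanDensity x₀ u x) - 2 * ∫ x in shell x₀ a b, radDensity x₀ u x =
        ∫ x in T, (tanDensity x₀ u x - 2 * radDensity x₀ u x) := by
      rw [← setIntegral_congr_set hae, ← setIntegral_congr_set hae, ← integral_const_mul, ← integral_sub hWt.1 (hWr.1.const_mul _)]
    rw [hgoal, setIntegral_congr_fun hTm hpt, integral_sub hW1.1 (hW3.1.const_mul _), integral_const_mul]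
    show (b ^ 3)⁻¹ * Φ b - (a ^ 3)⁻¹ * Φ a = _
    rw [hΦb]
    linarith [key]
  · ------------------------------------------------------------------ (iii) decay
    -- `D → 0` at infinity
    have hDlim : Tendsto D (cocompact E3) (𝓝 0) := by
      have h1 : Tendsto (fun x => p x - p₀) (cocompact E3) (𝓝 0) := by
        simpa using hp₀.sub_const p₀
      have h2 : Tendsto (fun x => ‖u x‖ ^ 2) (cocompact E3) (𝓝 0) := by
        simpa using ((tendsto_norm_zero.comp hD.2.2).pow 2)
      simpa [hD_def] using (h1.const_mul 3).add h2
    -- volume of balls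
    set c₁ : ℝ := volume.real (Metric.ball (0 : E3) 1) with hc₁_def
    have hc₁ : 0 ≤ c₁ := measureReal_nonneg
    have hvol : ∀ t : ℝ, 0 ≤ t → volume.real (Metric.closedBall x₀ t) = t ^ 3 * c₁ := by
      intro t ht
      rw [Measure.addHaar_real_closedBall volume x₀ ht, finrank_euclideanSpace_fin]
    rw [Metric.tendsto_atTop]
    intro ε' hε'
    -- choose the far-field tolerance
    set ε : ℝ := ε' / (2 * (c₁ + 1)) with hε_def
    have hε : 0 < ε := by positivity
    have hev : ∀ᶠ x in cocompact E3, |D x| ≤ ε := by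
      have := hDlim.eventually (Metric.closedBall_mem_nhds (0 : ℝ) hε)
      filter_upwards [this] with x hx
      simpa [Real.dist_eq] using hx
    obtain ⟨K, hK, hKsub⟩ := mem_cocompact.1 hev
    obtain ⟨R₀, hR₀⟩ := (Metric.isBounded_iff_subset_closedBall x₀).1 hK.isBounded
    set M₀ : ℝ := ∫ x in Metric.closedBall x₀ R₀, |D x| with hM₀_def
    have hM₀ : 0 ≤ M₀ := setIntegral_nonneg Metric.isClosed_closedBall.measurableSet fun x _ => abs_nonneg _
    -- pointwise domination of `|D|`
    have hdom : ∀ x, |D x| ≤ (Metric.closedBall x₀ R₀).indicator (fun x => |D x|) x + ε := by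
      intro x
      by_cases hx : x ∈ Metric.closedBall x₀ R₀
      · rw [Set.indicator_of_mem hx]; linarith
      · rw [Set.indicator_of_notMem hx, zero_add]
        have hxK : x ∉ K := fun h => hx (hR₀ h)
        exact hKsub (Set.mem_compl hxK)
    have hind_int : Integrable ((Metric.closedBall x₀ R₀).indicator fun x => |D x|) :=
      (hDc.abs.continuousOn.integrableOn_compact (isCompact_closedBall x₀ R₀)).integrable_indicator
        Metric.isClosed_closedBall.measurableSet
    -- the bound on `Φ`
    have hΦ : ∀ t, 0 ≤ t → |Φ t| ≤ M₀ + ε * (t ^ 3 * c₁) := by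
      intro t ht
      have hI : IntegrableOn D (Metric.closedBall x₀ t) volume :=
        hDc.continuousOn.integrableOn_compact (isCompact_closedBall x₀ t)
      have hlt : volume (Metric.closedBall x₀ t) < ⊤ := (isCompact_closedBall x₀ t).measure_lt_top
      calc |Φ t| = ‖∫ x in Metric.closedBall x₀ t, D x‖ := (Real.norm_eq_abs _).symm
        _ ≤ ∫ x in Metric.closedBall x₀ t, ‖D x‖ := norm_integral_le_integral_norm _
        _ ≤ ∫ x in Metric.closedBall x₀ t, ((Metric.closedBall x₀ R₀).indicator (fun x => |D x|) x + ε) := by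
            refine setIntegral_mono_on hI.norm (hind_int.integrableOn.add (integrableOn_const hlt.ne))
              Metric.isClosed_closedBall.measurableSet fun x _ => ?_
            rw [Real.norm_eq_abs]
            exact hdom x
        _ = (∫ x in Metric.closedBall x₀ t, (Metric.closedBall x₀ R₀).indicator (fun x => |D x|) x) +
              ε * (t ^ 3 * c₁) := by
            rw [integral_add hind_int.integrableOn (integrableOn_const hlt.ne), setIntegral_const, ← hvol t ht,
              smul_eq_mul, mul_comm]
        _ ≤ M₀ + ε * (t ^ 3 * c₁) := by
            have h1 : (∫ x in Metric.closedBall x₀ t, (Metric.closedBall x₀ R₀).indicator (fun x => |D x|) x) ≤ M₀ :=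
              calc (∫ x in Metric.closedBall x₀ t, (Metric.closedBall x₀ R₀).indicator (fun x => |D x|) x)
                  ≤ ∫ x, (Metric.closedBall x₀ R₀).indicator (fun x => |D x|) x :=
                    setIntegral_le_integral hind_int (Eventually.of_forall fun x =>
                      Set.indicator_nonneg (fun _ _ => abs_nonneg _) _)
                _ = M₀ := integral_indicator Metric.isClosed_closedBall.measurableSet
            linarith
    -- conclude
    refine ⟨max 1 (2 * M₀ / ε' + 1), fun t ht => ?_⟩
    have ht1 : 1 ≤ t := le_trans (le_max_left _ _) ht
    have ht0 : 0 < t := by linarith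
    have ht3 : t ≤ t ^ 3 := by
      have h2 : 1 ≤ t ^ 2 := by nlinarith
      calc t = t * 1 := (mul_one t).symm
        _ ≤ t * t ^ 2 := mul_le_mul_of_nonneg_left h2 ht0.le
        _ = t ^ 3 := by ring
    have hN : 2 * M₀ / ε' + 1 ≤ t := le_trans (le_max_right _ _) ht
    rw [Real.dist_eq, sub_zero, abs_mul, abs_inv, abs_of_pos (by positivity : (0 : ℝ) < t ^ 3)]
    have hA : (t ^ 3)⁻¹ * |Φ t| ≤ M₀ / t ^ 3 + ε * c₁ := by
      have := hΦ t ht0.le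
      have ht3pos : (0 : ℝ) < t ^ 3 := by positivity
      calc (t ^ 3)⁻¹ * |Φ t| ≤ (t ^ 3)⁻¹ * (M₀ + ε * (t ^ 3 * c₁)) :=
            mul_le_mul_of_nonneg_left this (by positivity)
        _ = M₀ / t ^ 3 + ε * c₁ := by field_simp
    have hB : M₀ / t ^ 3 < ε' / 2 := by
      have h1 : M₀ / t ^ 3 ≤ M₀ / t := div_le_div_of_nonneg_left hM₀ ht0 ht3
      have h2 : M₀ / t < ε' / 2 := by
        rw [div_lt_iff₀ ht0]
        have h3 : 2 * M₀ / ε' * ε' = 2 * M₀ := by field_simp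
        nlinarith
      linarith
    have hC : ε * c₁ < ε' / 2 := by
      rw [hε_def, div_mul_eq_mul_div, div_lt_div_iff₀ (by positivity) (by positivity)]
      nlinarith
    linarith

end Summit.NavierStokesRegularity.NavierStokesRegularity.Theorems.PoloidalLiouville.CentreVirial
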